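import Summits.NavierStokesRegularity.NavierStokesRegularity.Theorems.AdiabaticEddyChiralEddyExistsDensityN

/-!
# The quantity `J` of Gavrilov's ansatz and its positivity (support of `ChiralEddyExists`)

Helper file for item `stmt-NavierStokesRegularity-10397` (`ChiralEddyExists`, route AdiabaticEddy;
lands `--supports`).  With `N = ∇P × U` (file `…DensityN`) we form
`J := 2⟪N, ∇P × curl U⟫ + ⟪N, curl N⟫` (`J_eq`, generic ansatz), specialise to Gavrilov's local
solution at radius one using the second-order identity `Q_alpha` (which needs the profile ODE
`Hψ' = 6α + 12αψψ'`):  `J = 16 (H g (22ρ² − 3H'/2) − (3/2) H' g² + 24 ρ α H α_x)/(ρ²√H)`,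
`g = 12ρ²α − H` (`J_A1`), and prove `J > 0` together with `⟪U, curl U⟫ > 0` near the core circle
(`exists_Jfactor_pos`, `exists_pos_nbhd`; the bracket is `∼ 128 α²`).

Why `J`: for the modulated flows `Ũ = φ(P)U` the superhelicity `∫⟪curl Ũ, curl curl Ũ⟫` is a
quadratic form in the cutoff `φ`; if it vanished for all cutoffs, polarisation would force
`∫ φ'(P)² J = 0`, contradicting `J > 0` (file `…CutoffExists`).
-/

noncomputable section

set_option linter.dupNamespace false -- nested layout Summit.<S>.<Sub>, Sub = S (D-0017)

open Set Filter Function WithLp InnerProductSpace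
open scoped Topology RealInnerProductSpace

namespace Summit.NavierStokesRegularity.NavierStokesRegularity.Theorems.ChiralEddyExists

open Literature.Analysis.FluidPDE Literature.Analysis.FluidPDE.Gavrilov
  Literature.Analysis.FluidPDE.Gavrilov.AnsatzData

variable {A : AnsatzData} {X : EuclideanSpace ℝ (Fin 3)}

section Jfield

variable (hX : X ∈ A.tube)
include hX

/-- `⟪N, curl N⟫ = ρ⁻²(−16 |∇a|² M + 32 c (a_z(a_ρ a_ρz + a_z a_zz) + a_ρ(a_ρ a_ρρ + a_z a_ρz)))` with
`M = c Δ*a + c_ρ a_ρ + c_z a_z`, for `N = ∇P × U`. -/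
theorem inner_N_curl_N :
    ⟪cross (gradient A.P X) (A.U X), curl (fun Y => cross (gradient A.P Y) (A.U Y)) X⟫ =
      (cylRadius X)⁻¹ ^ 2 *
        (-(16 * (A.lax X ^ 2 + A.lay X ^ 2) *
            (A.lc X * (A.axx (meridian X) + A.ayy (meridian X) - A.ax (meridian X) * (cylRadius X)⁻¹)
              + A.cx (meridian X) * A.lax X + A.cy (meridian X) * A.lay X)) +
          32 * A.lc X * (A.lay X * (A.lax X * A.axy (meridian X) + A.lay X * A.ayy (meridian X)) +
            A.lax X * (A.lax X * A.axx (meridian X) + A.lay X * A.axy (meridian X)))) := by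
  obtain ⟨-, h0, h1, h2⟩ := curl_N hX
  have h : ⟪cross (gradient A.P X) (A.U X), curl (fun Y => cross (gradient A.P Y) (A.U Y)) X⟫ =
      cross (gradient A.P X) (A.U X) 0 * curl (fun Y => cross (gradient A.P Y) (A.U Y)) X 0 +
      cross (gradient A.P X) (A.U X) 1 * curl (fun Y => cross (gradient A.P Y) (A.U Y)) X 1 +
      cross (gradient A.P X) (A.U X) 2 * curl (fun Y => cross (gradient A.P Y) (A.U Y)) X 2 := by
    simp [PiLp.inner_apply, Fin.sum_univ_three, mul_comm]
  rw [h, h0, h1, h2, cross_gradP_U_apply_zero hX, cross_gradP_U_apply_one hX,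
    cross_gradP_U_apply_two hX]
  have hr := cylRadius_ne_zero hX
  have hS := sumSq_ne_zero hX
  simp only [lay, lax, lc, meridian_apply]
  field_simp
  ring

/-- `⟪N, ∇P × curl U⟫ = 16 |∇a|² ρ⁻² (c Δ*a − c_ρ a_ρ − c_z a_z) = |∇P|² ⟪U, curl U⟫`. -/
theorem inner_N_cross_gradP_curlU :
    ⟪cross (gradient A.P X) (A.U X), cross (gradient A.P X) (curl A.U X)⟫ =
      16 * (A.lax X ^ 2 + A.lay X ^ 2) * ((cylRadius X)⁻¹ ^ 2 *
        (A.lc X * (A.axx (meridian X) + A.ayy (meridian X) - A.ax (meridian X) * (cylRadius X)⁻¹)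
          - A.lay X * A.cy (meridian X) - A.lax X * A.cx (meridian X))) := by
  have h : ∀ v w : EuclideanSpace ℝ (Fin 3), ⟪v, w⟫ = v 0 * w 0 + v 1 * w 1 + v 2 * w 2 := by
    intro v w
    simp [PiLp.inner_apply, Fin.sum_univ_three, mul_comm]
  rw [h, cross_gradP_U_apply_zero hX, cross_gradP_U_apply_one hX, cross_gradP_U_apply_two hX]
  have hc : ∀ i, cross (gradient A.P X) (curl A.U X) i =
      ![gradient A.P X 1 * curl A.U X 2 - gradient A.P X 2 * curl A.U X 1,
        gradient A.P X 2 * curl A.U X 0 - gradient A.P X 0 * curl A.U X 2,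
        gradient A.P X 0 * curl A.U X 1 - gradient A.P X 1 * curl A.U X 0] i := by
    intro i
    simp [cross, cross_apply]
  rw [hc 0, hc 1, hc 2, gradient_P_eq hX, curl_U_apply_zero hX, curl_U_apply_one hX, curl_U_apply_two hX]
  have hr := cylRadius_ne_zero hX
  have hS := sumSq_ne_zero hX
  have hr2 := cylRadius_sq X
  have h3 : cylRadius X ^ 3 = (X 0 ^ 2 + X 1 ^ 2) * cylRadius X := by rw [← hr2]; ring
  simp only [lay, lax, lc, meridian_apply]
  simp
  field_simp
  ring_nf
  simp only [hr2, h3]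
  ring

/-- **The quantity `J = 2⟪N, ∇P × curl U⟫ + ⟪N, curl N⟫ of the ansatz**:
`J = ρ⁻²(16 |∇a|² c Δ*a − 48 |∇a|² (c_ρ a_ρ + c_z a_z) + 32 c (a_ρ² a_ρρ + 2 a_ρ a_z a_ρz + a_z² a_zz))`. -/
theorem J_eq :
    2 * ⟪cross (gradient A.P X) (A.U X), cross (gradient A.P X) (curl A.U X)⟫ +
      ⟪cross (gradient A.P X) (A.U X), curl (fun Y => cross (gradient A.P Y) (A.U Y)) X⟫ =
      (cylRadius X)⁻¹ ^ 2 *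
        (16 * (A.lax X ^ 2 + A.lay X ^ 2) * A.lc X *
            (A.axx (meridian X) + A.ayy (meridian X) - A.ax (meridian X) * (cylRadius X)⁻¹)
          - 48 * (A.lax X ^ 2 + A.lay X ^ 2) * (A.cx (meridian X) * A.lax X + A.cy (meridian X) * A.lay X)
          + 32 * A.lc X * (A.lax X ^ 2 * A.axx (meridian X) + 2 * A.lax X * A.lay X * A.axy (meridian X)
              + A.lay X ^ 2 * A.ayy (meridian X))) := by
  rw [inner_N_cross_gradP_curlU hX, inner_N_curl_N hX]
  ring

end Jfield

/-! ### Specialisation to Gavrilov's solution at radius one -/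

section GavrilovJ

variable {D : ProfileData} {q : ℝ × ℝ}

/-- The second-order identity `α_x² α_xx + 2 α_x α_y α_xy + α_y² α_yy = 12 x α α_x +
(6x² − H'(α)/2)(12x²α − H(α))` (i.e. `½ ∇α·∇|∇α|²`), a consequence of the chart identities and the
profile equation `Hψ' = 6α + 12αψψ'`. -/
theorem Q_alpha (hq : q ∈ D.locDom) :
    D.alphaX q ^ 2 * D.alphaXX q + 2 * D.alphaX q * D.alphaY q * D.alphaXY q +
        D.alphaY q ^ 2 * D.alphaYY q =
      12 * q.1 * D.alpha q * D.alphaX q +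
        (6 * q.1 ^ 2 - D.gH' (D.alpha q) / 2) * (12 * q.1 ^ 2 * D.alpha q - D.H (D.alpha q)) := by
  obtain ⟨hxx, hxy, hyy⟩ := ProfileData.alpha_second_derivs hq
  have hF := ProfileData.gF_alpha hq
  have hG := ProfileData.gG_alpha hq
  have hODE := D.H_mul_χ (D.alpha q) (ProfileData.abs_alpha_lt hq)
  have hGdef : D.gG (q.1, D.alpha q) =
      12 * q.1 ^ 2 * D.alpha q - D.gF (q.1, D.alpha q) ^ 2 - D.H (D.alpha q) := rfl
  have hFdef : D.gF (q.1, D.alpha q) = 2 * q.1 ^ 3 - 2 * q.1 * D.ψ (D.alpha q) := rfl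
  rw [hxx, hxy, hyy]
  simp only [ProfileData.gFx, ProfileData.gFa, ProfileData.gGa, ProfileData.gH']
  rw [hF] at hGdef ⊢
  rw [hG] at hGdef
  rw [hF] at hFdef
  -- now: alphaY² = 12x²α − alphaX² − H, alphaX = 2x³ − 2xψ, Hχ = 6α + 12αψχ
  ring_nf
  simp only [hGdef]
  simp only [hFdef]
  linear_combination (2 * q.1 * (2 * q.1 ^ 3 - 2 * q.1 * D.ψ (D.alpha q))) * hODE


variable {a₀ : ℝ} {hH : ∀ a : ℝ, 0 < a → a < a₀ → 0 < D.H a} {X : EuclideanSpace ℝ (Fin 3)}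

/-- **`J` for Gavrilov's flow at radius one**: with `α = α(ρ,z)`, `g = 12ρ²α − H(α)`,
`J = 16 (H(α) g (22ρ² − 3H'(α)/2) − (3/2) H'(α) g² + 24 ρ α H(α) α_x) / (ρ² √H(α))`. -/
theorem J_A1 (hX : X ∈ (D.ansatz one_pos hH).tube) :
    2 * ⟪cross (gradient (D.ansatz one_pos hH).P X) ((D.ansatz one_pos hH).U X),
        cross (gradient (D.ansatz one_pos hH).P X) (curl (D.ansatz one_pos hH).U X)⟫ +
      ⟪cross (gradient (D.ansatz one_pos hH).P X) ((D.ansatz one_pos hH).U X),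
        curl (fun Y => cross (gradient (D.ansatz one_pos hH).P Y) ((D.ansatz one_pos hH).U Y)) X⟫ =
      16 * (D.H (D.alpha (meridian X)) * (12 * cylRadius X ^ 2 * D.alpha (meridian X) - D.H (D.alpha (meridian X)))
              * (22 * cylRadius X ^ 2 - 3 / 2 * D.gH' (D.alpha (meridian X)))
            - 3 / 2 * D.gH' (D.alpha (meridian X)) *
              (12 * cylRadius X ^ 2 * D.alpha (meridian X) - D.H (D.alpha (meridian X))) ^ 2
            + 24 * cylRadius X * D.alpha (meridian X) * D.H (D.alpha (meridian X)) * D.alphaX (meridian X)) /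
        (cylRadius X ^ 2 * Real.sqrt (D.H (D.alpha (meridian X)))) := by
  obtain ⟨hm, hr, -, -, hHpos⟩ := tube_A1_facts hX
  have hr' : cylRadius X ≠ 0 := hr.ne'
  have hq1 : (meridian X).1 = cylRadius X := rfl
  have hN := normSq_grad_alpha hm
  have hL := lapStar_alpha hm (by rw [hq1]; exact hr')
  have hQ := Q_alpha hm
  rw [hq1] at hN hL hQ
  set s := Real.sqrt (D.H (D.alpha (meridian X))) with hs
  have hs0 : 0 < s := Real.sqrt_pos.2 hHpos
  have hs2 : s ^ 2 = D.H (D.alpha (meridian X)) := Real.sq_sqrt hHpos.le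
  rw [← hs2] at hN hQ ⊢
  rw [J_eq hX]
  simp only [AnsatzData.lax, AnsatzData.lay, AnsatzData.lc, A1_c, A1_ax, A1_ay, A1_axx, A1_axy, A1_ayy,
    A1_cx, A1_cy]
  rw [← hs, hL, hQ]
  field_simp
  linear_combination (-24 * (12 * cylRadius X ^ 2 * D.alpha (meridian X) - s ^ 2) *
      D.gH' (D.alpha (meridian X)) +
    (-48 * D.gH' (D.alpha (meridian X)) * (D.alphaX (meridian X) ^ 2 + D.alphaY (meridian X) ^ 2 +
        (12 * cylRadius X ^ 2 * D.alpha (meridian X) - s ^ 2)) +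
      320 * s ^ 2 * cylRadius X ^ 2 - 40 * s ^ 2 * D.gH' (D.alpha (meridian X)) +
      288 * cylRadius X ^ 2 * D.gH' (D.alpha (meridian X)) * D.alpha (meridian X))) * hN


/-- The bracket `Ĵ = H̄(12x² − H̄)(22x² − 3H'/2) − (3/2)H'(12x² − H̄)² + 24 x H̄ α_x`, `H̄ = H(α)/α`,
tends to `128` at the circle point `(1, 0)` (where `H̄ → 4`, `H' → 4`, `α_x → 0`), hence the
numerator of `J` is positive on a punctured neighbourhood: quantitatively, there is `δ > 0` with
`H g (22x² − 3H'/2) − (3/2) H' g² + 24 x α H α_x > 0`, `g = 12x²α − H`, for `q ∈ locDom`,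
`q ≠ (1,0)`, `dist q (1,0) < δ`. -/
theorem exists_Jfactor_pos (D : ProfileData) :
    ∃ δ : ℝ, 0 < δ ∧ ∀ q ∈ D.locDom, q ≠ (1, 0) → dist q (1, 0) < δ →
      0 < D.H (D.alpha q) * (12 * q.1 ^ 2 * D.alpha q - D.H (D.alpha q)) *
            (22 * q.1 ^ 2 - 3 / 2 * D.gH' (D.alpha q))
          - 3 / 2 * D.gH' (D.alpha q) * (12 * q.1 ^ 2 * D.alpha q - D.H (D.alpha q)) ^ 2
          + 24 * q.1 * D.alpha q * D.H (D.alpha q) * D.alphaX q := by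
  set S : Set (ℝ × ℝ) := D.locDom \ {((1 : ℝ), (0 : ℝ))} with hS
  have hmem : ((1 : ℝ), (0 : ℝ)) ∈ D.locDom := ProfileData.one_zero_mem_locDom
  -- the four limits
  have T1 : Tendsto (fun q : ℝ × ℝ => q.1) (𝓝[S] ((1 : ℝ), (0 : ℝ))) (𝓝 1) :=
    (continuous_fst.tendsto ((1 : ℝ), (0 : ℝ))).mono_left nhdsWithin_le_nhds
  have hαc : ContinuousWithinAt D.alpha S ((1 : ℝ), (0 : ℝ)) :=
    ((ProfileData.contDiffOn_alpha (D := D)).continuousOn.continuousWithinAt hmem).mono_of_mem_nhdsWithin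
      (mem_nhdsWithin_of_mem_nhds (ProfileData.isOpen_locDom.mem_nhds hmem)) |>.mono sdiff_subset
  have T2' : Tendsto D.alpha (𝓝[S] ((1 : ℝ), (0 : ℝ))) (𝓝 0) := by
    have := hαc.tendsto
    rwa [ProfileData.alpha_one_zero] at this
  have T2 : Tendsto D.alpha (𝓝[S] ((1 : ℝ), (0 : ℝ))) (𝓝[>] 0) := by
    refine tendsto_nhdsWithin_iff.2 ⟨T2', ?_⟩
    refine eventually_nhdsWithin_of_forall fun q hq => ?_
    exact ProfileData.alpha_pos hq.1 hq.2
  have hH0 : HasDerivAt D.H 4 0 := by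
    have h := D.hasDerivAt_H 0 (by norm_num)
    simpa [D.ψ_zero] using h
  have T3 : Tendsto (fun a => D.H a / a) (𝓝[>] (0 : ℝ)) (𝓝 4) := by
    have h := (hasDerivAt_iff_tendsto_slope.1 hH0).mono_left
      (nhdsWithin_mono _ (show Ioi (0 : ℝ) ⊆ {0}ᶜ from fun a ha => ne_of_gt ha))
    refine h.congr' (eventually_nhdsWithin_of_forall fun a _ => ?_)
    rw [slope_def_field, D.H_zero, sub_zero, sub_zero]
  have T3' : Tendsto (fun q => D.H (D.alpha q) / D.alpha q) (𝓝[S] ((1 : ℝ), (0 : ℝ))) (𝓝 4) :=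
    T3.comp T2
  have hψc : ContinuousAt D.ψ 0 :=
    D.contDiffOn_ψ.continuousOn.continuousAt (Metric.isOpen_ball.mem_nhds (by simp))
  have hχc : ContinuousAt D.χ 0 :=
    D.contDiffOn_χ.continuousOn.continuousAt (Metric.isOpen_ball.mem_nhds (by simp))
  have hgc : ContinuousAt (fun a => D.gH' a) 0 := by
    have : ContinuousAt (fun a => 4 * D.ψ a + 24 * a * D.χ a) 0 :=
      (continuousAt_const.mul hψc).add ((continuousAt_const.mul continuousAt_id).mul hχc)
    exact this
  have T4 : Tendsto (fun q => D.gH' (D.alpha q)) (𝓝[S] ((1 : ℝ), (0 : ℝ))) (𝓝 4) := by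
    have h := hgc.tendsto.comp T2'
    simp only [ProfileData.gH'_zero] at h
    exact h
  have T5 : Tendsto D.alphaX (𝓝[S] ((1 : ℝ), (0 : ℝ))) (𝓝 0) := by
    have hc : ContinuousWithinAt D.alphaX S ((1 : ℝ), (0 : ℝ)) :=
      ((ProfileData.contDiffOn_alphaX (D := D)).continuousOn.continuousWithinAt hmem).mono_of_mem_nhdsWithin
        (mem_nhdsWithin_of_mem_nhds (ProfileData.isOpen_locDom.mem_nhds hmem)) |>.mono sdiff_subset
    have := hc.tendsto
    rwa [ProfileData.alphaX_one_zero] at this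
  -- the bracket as a continuous function of the four quantities
  have hP : Continuous fun v : ℝ × ℝ × ℝ × ℝ =>
      v.2.1 * (12 * v.1 ^ 2 - v.2.1) * (22 * v.1 ^ 2 - 3 / 2 * v.2.2.1)
        - 3 / 2 * v.2.2.1 * (12 * v.1 ^ 2 - v.2.1) ^ 2 + 24 * v.1 * v.2.1 * v.2.2.2 := by
    fun_prop
  have hT := (hP.tendsto ((1 : ℝ), (4 : ℝ), (4 : ℝ), (0 : ℝ))).comp
    (T1.prodMk_nhds (T3'.prodMk_nhds (T4.prodMk_nhds T5)))
  norm_num only at hT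
  have hev := hT.eventually (lt_mem_nhds (show (64 : ℝ) < 128 by norm_num))
  rw [eventually_nhdsWithin_iff, Metric.eventually_nhds_iff] at hev
  obtain ⟨δ, hδ, hball⟩ := hev
  refine ⟨δ, hδ, fun q hq hq1 hdist => ?_⟩
  have hB := hball hdist ⟨hq, hq1⟩
  simp only [Function.comp_apply] at hB
  have hα : 0 < D.alpha q := ProfileData.alpha_pos hq hq1
  -- numerator = α² · bracket
  have key : D.H (D.alpha q) * (12 * q.1 ^ 2 * D.alpha q - D.H (D.alpha q)) *
        (22 * q.1 ^ 2 - 3 / 2 * D.gH' (D.alpha q))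
      - 3 / 2 * D.gH' (D.alpha q) * (12 * q.1 ^ 2 * D.alpha q - D.H (D.alpha q)) ^ 2
      + 24 * q.1 * D.alpha q * D.H (D.alpha q) * D.alphaX q =
      D.alpha q ^ 2 * (D.H (D.alpha q) / D.alpha q * (12 * q.1 ^ 2 - D.H (D.alpha q) / D.alpha q) *
        (22 * q.1 ^ 2 - 3 / 2 * D.gH' (D.alpha q))
        - 3 / 2 * D.gH' (D.alpha q) * (12 * q.1 ^ 2 - D.H (D.alpha q) / D.alpha q) ^ 2
        + 24 * q.1 * (D.H (D.alpha q) / D.alpha q) * D.alphaX q) := by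
    field_simp
  rw [key]
  have : (64 : ℝ) < _ := hB
  positivity


/-- **Positivity near the core circle.** For Gavrilov's ansatz at radius one there is `δ > 0`
such that at every point of the tube whose meridian point is `δ`-close to the circle point
`(1, 0)`, both the helicity density `⟪U, curl U⟫` and the quantity
`J = 2⟪N, ∇P × curl U⟫ + ⟪N, curl N⟫` (`N = ∇P × U`) are strictly positive. -/
theorem exists_pos_nbhd (D : ProfileData) (hH : ∀ a : ℝ, 0 < a → a < a₀ → 0 < D.H a) :
    ∃ δ : ℝ, 0 < δ ∧ ∀ X ∈ (D.ansatz one_pos hH).tube, dist (meridian X) (1, 0) < δ →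
      0 < ⟪(D.ansatz one_pos hH).U X, curl (D.ansatz one_pos hH).U X⟫ ∧
      0 < 2 * ⟪cross (gradient (D.ansatz one_pos hH).P X) ((D.ansatz one_pos hH).U X),
          cross (gradient (D.ansatz one_pos hH).P X) (curl (D.ansatz one_pos hH).U X)⟫ +
        ⟪cross (gradient (D.ansatz one_pos hH).P X) ((D.ansatz one_pos hH).U X),
          curl (fun Y => cross (gradient (D.ansatz one_pos hH).P Y) ((D.ansatz one_pos hH).U Y)) X⟫ := by
  obtain ⟨a₁, ha₁, hfac⟩ := exists_helicityFactor_pos D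
  obtain ⟨δ₃, hδ₃, hJ⟩ := exists_Jfactor_pos D
  -- `α < a₁` near the circle point
  have hmem : ((1 : ℝ), (0 : ℝ)) ∈ D.locDom := ProfileData.one_zero_mem_locDom
  have hαc : ContinuousAt D.alpha ((1 : ℝ), (0 : ℝ)) :=
    (ProfileData.contDiffOn_alpha (D := D)).continuousOn.continuousAt
      (ProfileData.isOpen_locDom.mem_nhds hmem)
  have hev : ∀ᶠ q in 𝓝 ((1 : ℝ), (0 : ℝ)), D.alpha q < a₁ :=
    hαc.eventually (gt_mem_nhds (by rw [ProfileData.alpha_one_zero]; exact ha₁))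
  rw [Metric.eventually_nhds_iff] at hev
  obtain ⟨δ₂, hδ₂, hball⟩ := hev
  refine ⟨min δ₂ δ₃, lt_min hδ₂ hδ₃, fun X hX hdist => ?_⟩
  obtain ⟨hm, hr, hαpos, -, hHpos⟩ := tube_A1_facts hX
  have hne : meridian X ≠ (1, 0) := ((mem_tube_A1_iff hH).1 hX).2
  have hd₂ : dist (meridian X) (1, 0) < δ₂ := lt_of_lt_of_le hdist (min_le_left _ _)
  have hd₃ : dist (meridian X) (1, 0) < δ₃ := lt_of_lt_of_le hdist (min_le_right _ _)
  have hlt : D.alpha (meridian X) < a₁ := hball hd₂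
  have hs0 : 0 < Real.sqrt (D.H (D.alpha (meridian X))) := Real.sqrt_pos.2 hHpos
  constructor
  · rw [inner_U_curl_U_A1 hX]
    have := hfac _ hαpos hlt
    positivity
  · rw [J_A1 hX]
    have hnum := hJ _ hm hne hd₃
    have hq1 : (meridian X).1 = cylRadius X := rfl
    rw [hq1] at hnum
    positivity

end GavrilovJ

end Summit.NavierStokesRegularity.NavierStokesRegularity.Theorems.ChiralEddyExists
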